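import Summits.Ventures.AbcSig.Rows.Bridge
import Summits.Ventures.AbcSig.Rows.C2aL283A45X
import Summits.Ventures.AbcSig.Rows.C2aL283A45XAB

/-!
# Venture AbcSig — CELL `C2aL283A45`: the census statement `Rows.C2aCellRed 283 (fun a => a = 4 ∨ a = 5) ∅` from the two row theorems

HONEST FRAMING. COMPUTATION cell `pub-abcsig`; CONDITIONAL theorem; no claim on ABC or any summit. Hypotheses exactly as
in `Rows/C2aL283A45X.lean` and `Rows/C2aL283A45XAB.lean`: `BS04Package` (CITED), `DataComplete …` (COMPUTED level files), `EisPackage` (CITED) and `Refines` (COMPUTED) for the M6 orbits discharged in the kernel, and the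
rows' per-orbit exclusions for BOTH family predicates (`famB`, `famAB`) as universally quantified hypotheses (CITED: the census
row's certificates). Conclusion = p1's census predicate (`Rows/Statements.lean`), all four coprime coefficient
distributions `A·B = 2^a·283^m`, reduced exponents `a < n`, `m < n` (RULING H1). GENERATED by p-lean g2 gen/make_rows.py
(after plean/make_cell_bridges.py).
-/

namespace Summit.Ventures.AbcSig

/-- Cell `C2aL283A45` (M6 orbits discharged in the kernel): `Rows.C2aCellRed 283 (fun a => a = 4 ∨ a = 5) ∅` under the rows' hypotheses. -/
theorem xcell_C2aL283A45 (M : NewformModel) (hP : M.BS04Package)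
    (hE : M.EisPackage)
    (hD566 : M.DataComplete 566 level566Orbits)
    (hD2264 : M.DataComplete 2264 level2264Orbits)
    (hR_orbit_566_7 : M.Refines 566 orbit_566_7 m6X_566_7)
    (hX_orbit_2264_7 : ∀ n a m : ℕ, n ∈ ([11] : List ℕ) → M.Excludes 2264 orbit_2264_7 (famB (2 ^ a * 283 ^ m) n (fun _ _ => True)))
    (hX_orbit_2264_7' : ∀ n a m : ℕ, n ∈ ([11] : List ℕ) → M.Excludes 2264 orbit_2264_7 (famAB (283 ^ m) (2 ^ a) n (fun _ _ => True)))
    (hX_orbit_2264_8 : ∀ n a m : ℕ, n ∈ ([13] : List ℕ) → M.Excludes 2264 orbit_2264_8 (famB (2 ^ a * 283 ^ m) n (fun _ _ => True)))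
    (hX_orbit_2264_8' : ∀ n a m : ℕ, n ∈ ([13] : List ℕ) → M.Excludes 2264 orbit_2264_8 (famAB (283 ^ m) (2 ^ a) n (fun _ _ => True))) :
    Rows.C2aCellRed 283 (fun a => a = 4 ∨ a = 5) ∅ :=
  C2aCellRed_of_rows 283 (by norm_num) (by norm_num) _ _
    (fun n hn h11 hnℓ _ a m ha han hm hmn x y z h1 h2 =>
      xrow_C2aL283A45 M hP hE hD566 hD2264 hR_orbit_566_7 n hn h11 hnℓ a m ha hm han hmn (hX_orbit_2264_7 n a m) (hX_orbit_2264_8 n a m) x y z h1 h2)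
    (fun n hn h11 hnℓ _ a m ha han hm hmn x y z h1 h2 =>
      xrow_C2aL283A45AB M hP hE hD566 hD2264 hR_orbit_566_7 n hn h11 hnℓ a m ha hm han hmn (hX_orbit_2264_7' n a m) (hX_orbit_2264_8' n a m) x y z h1 h2)

end Summit.Ventures.AbcSig
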